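import Summits.CriticalPhenomena.SAWScalingLimit.Theses.SAWPhaseRetrieval
import Summits.CriticalPhenomena.SAWScalingLimit.Theorems.SAWPhaseRetrievalRetrievalStabilityDiscAlgebra
import Summits.CriticalPhenomena.SAWScalingLimit.Theorems.SAWPhaseRetrievalRetrievalStabilityDiscLattice
import Summits.CriticalPhenomena.SAWScalingLimit.Theorems.SAWPhaseRetrievalRetrievalStabilityDiscCover
import Summits.CriticalPhenomena.SAWScalingLimit.Theorems.SAWPhaseRetrievalRetrievalStabilityDiscBox
import Summits.CriticalPhenomena.SAWScalingLimit.Theorems.SAWPhaseRetrievalRetrievalStabilityDiscTile4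
import Literature.Probability.LatticeModels.TriangularLatticeProofs
import Literature.Barriers.CriticalPhenomena.ParafermionicHalfCauchyRiemann

/-!
# Retrieval stability, disc case — the main estimate and the proof of `RetrievalStabilityDisc`

Proof of `SAWPhaseRetrieval.RetrievalStabilityDisc` (stmt-CriticalPhenomena-11413).
At mesh `δ ≤ 1/200`, with `ρ = ⌊1/(8δ)⌋`, the edges of the domain whose scaled midpoints lie in
the closed unit ball are covered by the `≤ 441` rhombus tiles `(P,Q)`, `max(|P|,|Q|,|P-Q|) ≤ 10`,
of side `ρ`; on each tile the values `‖G‖` deviate in `ℓ¹` from the common scale `s = ℓ(0,0)/ρ`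
by `≤ 160 √ε ρ ℓ(0,0)` (tile estimate + common scale), so
`δ² Σ_e |‖G e‖/s - 1| ≤ 441 · 160 √ε (δρ)² ≤ 1200 √ε`.  Choosing `ε = min(1/1000, (η/1200)²)`
proves the route statement: **RetrievalStabilityDisc holds**.
-/

namespace Summit.CriticalPhenomena.SAWScalingLimit.Theorems

open Literature.Probability.LatticeModels Literature.Probability.Percolation
  Literature.Probability.RandomPlanarGeometry.SAW Literature.Barriers.CriticalPhenomena
  Complex Finset


/-- **Tile coordinates of a lattice point.** A point `![a,b]` with `-10ρ ≤ a ≤ 10ρ`,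
`-10ρ ≤ b < 10ρ`, `-10ρ ≤ a+b < 10ρ` lies in the cell `(s,t)` of the tile `(P,Q)` with
`max(|P|,|Q|,|P-Q|) ≤ 10`: `a = Pρ - Qρ + s - t`, `b = Qρ + t`, `0 ≤ s, t < ρ`. [folklore] -/
theorem rsd_cover_coords {a b ρ : ℤ} (hρ : 0 < ρ) (ha1 : -(10 * ρ) ≤ a) (ha2 : a ≤ 10 * ρ)
    (hb1 : -(10 * ρ) ≤ b) (hb2 : b < 10 * ρ) (hab1 : -(10 * ρ) ≤ a + b) (hab2 : a + b < 10 * ρ) :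
    ∃ P Q : ℤ, ∃ s t : ℕ, |P| ≤ 10 ∧ |Q| ≤ 10 ∧ |P - Q| ≤ 10 ∧ (s : ℤ) < ρ ∧ (t : ℤ) < ρ ∧
      a = P * ρ - Q * ρ + s - t ∧ b = Q * ρ + t := by
  obtain ⟨eb, tb0, tb1⟩ := rsd_floor_decomp b hρ
  obtain ⟨eab, sb0, sb1⟩ := rsd_floor_decomp (a + b) hρ
  obtain ⟨q1, q2⟩ := rsd_floor_bounds hρ hb1 hb2
  obtain ⟨p1, p2⟩ := rsd_floor_bounds hρ hab1 hab2
  refine ⟨(a + b) / ρ, b / ρ, ((a + b) % ρ).toNat, (b % ρ).toNat, abs_le.2 ⟨p1, by linarith⟩,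
    abs_le.2 ⟨q1, by linarith⟩, ?_, ?_, ?_, ?_, ?_⟩
  · -- |P - Q| ≤ 10 from (P - Q) ρ = a - s + t
    have key : ((a + b) / ρ - b / ρ) * ρ = a - (a + b) % ρ + b % ρ := by linarith
    rw [abs_le]
    constructor
    · by_contra h
      have h' : (a + b) / ρ - b / ρ ≤ -11 := by omega
      have : ((a + b) / ρ - b / ρ) * ρ ≤ -11 * ρ := by nlinarith
      linarith
    · by_contra h
      have h' : 11 ≤ (a + b) / ρ - b / ρ := by omega
      have : 11 * ρ ≤ ((a + b) / ρ - b / ρ) * ρ := by nlinarith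
      linarith
  · rw [Int.toNat_of_nonneg sb0]; exact sb1
  · rw [Int.toNat_of_nonneg tb0]; exact tb1
  · rw [Int.toNat_of_nonneg sb0, Int.toNat_of_nonneg tb0]; linarith
  · rw [Int.toNat_of_nonneg tb0]; linarith

/-- **Main estimate.** At mesh `0 < δ ≤ 1/200`: if every face with scaled centre in the closed ball
of radius `2.95` belongs to `Λ`, `G` satisfies the vertex relations on `Λ` and has phases within
`ε ≤ 1/1000` of `1` on the mid-edges of `Λ` with scaled midpoint in the closed ball of radius `2`,
then for the scale `s = ℓ(0,0)/ρ > 0`: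
`δ² Σ_{e : ‖δ mid e‖ ≤ 1} |‖G e‖/s - 1| ≤ 1200 √ε`. [folklore] -/
theorem rsd_main (Λ : Finset HexVertex) (G : Sym2 HexVertex → ℂ) {δ ε : ℝ} (hδ0 : 0 < δ)
    (hδ : δ ≤ 1 / 200) (hε : 0 < ε) (hε1 : ε ≤ 1 / 1000)
    (hK : ∀ v : HexVertex, ‖(δ : ℂ) * hexCenter v‖ ≤ 2.95 → v ∈ Λ)
    (hrel : SatisfiesVertexRelations Λ G)
    (hphase : ∀ e : Sym2 HexVertex, e ∈ hexDomainMidEdges Λ → ‖(δ : ℂ) * hexMidpoint e‖ ≤ 2 →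
      G e ≠ 0 ∧ ‖G e / ((‖G e‖ : ℝ) : ℂ) - 1‖ ≤ ε) :
    ∃ s : ℝ, 0 < s ∧ δ ^ 2 * (∑ᶠ e ∈ {e : Sym2 HexVertex | e ∈ hexDomainMidEdges Λ ∧
      (δ : ℂ) * hexMidpoint e ∈ Metric.closedBall (0 : ℂ) 1}, |‖G e‖ / s - 1|) ≤
      1200 * Real.sqrt ε := by
  -- the tile side
  set ρ : ℕ := ⌊1 / (8 * δ)⌋₊ with hρdef
  have hx : (200 : ℝ) ≤ 1 / δ := by rw [le_one_div (by norm_num) hδ0]; linarith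
  have hρle : (ρ : ℝ) ≤ 1 / (8 * δ) := Nat.floor_le (by positivity)
  have hρgt : 1 / (8 * δ) < ρ + 1 := Nat.lt_floor_add_one _
  have h8 : (1 : ℝ) / (8 * δ) = (1 / δ) / 8 := by field_simp
  have hρ24 : (24 : ℝ) ≤ ρ := by rw [h8] at hρgt; linarith
  have hρ1 : 1 ≤ ρ := by exact_mod_cast (show (1 : ℝ) ≤ ρ by linarith)
  have hρZ : (0 : ℤ) < ρ := by exact_mod_cast hρ1
  have hρR : (0 : ℝ) < ρ := by exact_mod_cast hρ1
  have hρδ : (ρ : ℝ) * δ ≤ 1 / 8 := by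
    have h8' : (1 : ℝ) / (8 * δ) * δ = 1 / 8 := by field_simp
    have := mul_le_mul_of_nonneg_right hρle hδ0.le
    rwa [h8'] at this
  -- box data
  obtain ⟨p, bH, bV, bD⟩ := rsd_box_potential hδ0 hδ hρle hK hrel
  have bP := fun a b h1 h2 h3 => (rsd_box_phase hδ0 hδ hρle hK hphase a b h1 h2 h3).1
  -- reference lengths
  set ℓ : ℤ → ℤ → ℝ := fun P Q => ∑ k ∈ range ρ, ‖G s((![P * ρ - Q * ρ, Q * ρ + k], 0), (![P * ρ - Q * ρ - 1, Q * ρ + k], 1))‖ with hℓ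
  have ℓnn : ∀ P Q, 0 ≤ ℓ P Q := fun P Q => Finset.sum_nonneg fun _ _ => norm_nonneg _
  have hℓ0 : 0 < ℓ 0 0 := by
    have h11 : (0 : ℤ) ≤ 11 * ρ + 2 := by positivity
    have hnz := (rsd_box_phase hδ0 hδ hρle hK hphase (0 * ρ - 0 * ρ) (0 * ρ + ((0 : ℕ) : ℤ))
      (by simpa using h11) (by simpa using h11) (by simpa using h11)).2.2.1
    have hmem : (0 : ℕ) ∈ range ρ := Finset.mem_range.2 hρ1
    have := Finset.single_le_sum (f := fun k : ℕ => ‖G s((![0 * ρ - 0 * ρ, 0 * ρ + (k : ℤ)], 0), (![0 * ρ - 0 * ρ - 1, 0 * ρ + (k : ℤ)], 1))‖)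
      (fun _ _ => norm_nonneg _) hmem
    exact (norm_pos_iff.2 hnz).trans_le this
  set s₀ : ℝ := ℓ 0 0 / ρ with hs₀
  have hs₀pos : 0 < s₀ := div_pos hℓ0 hρR
  refine ⟨s₀, hs₀pos, ?_⟩
  -- per tile
  have hsε0 : 0 ≤ Real.sqrt ε := Real.sqrt_nonneg ε
  have hsε : ε = Real.sqrt ε * Real.sqrt ε := (Real.mul_self_sqrt hε.le).symm
  have hsε1 : Real.sqrt ε ≤ 1 / 31 := by
    rw [Real.sqrt_le_left (by norm_num)]; norm_num; linarith
  have tile : ∀ P Q : ℤ, |P| ≤ 10 → |Q| ≤ 10 → |P - Q| ≤ 10 →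
      ∑ s ∈ range ρ, ∑ t ∈ range ρ,
        (|‖G s((![P * ρ - Q * ρ + s - t, Q * ρ + t], 0), (![P * ρ - Q * ρ + s - t, Q * ρ + t - 1], 1))‖ - s₀| +
          |‖G s((![P * ρ - Q * ρ + s - t, Q * ρ + t], 0), (![P * ρ - Q * ρ + s - t - 1, Q * ρ + t], 1))‖ - s₀| +
          |‖G s((![P * ρ - Q * ρ + s - t, Q * ρ + t], 0), (![P * ρ - Q * ρ + s - t, Q * ρ + t], 1))‖ - s₀|) ≤ 160 * Real.sqrt ε * ρ * ℓ 0 0 := by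
    intro P Q hP hQ hPQ
    have est := (rsd_tile_facts bH bV bD bP hε.le hε1 hρ1 P Q hP hQ hPQ).1
    have sc := rsd_scales bH bV bD bP hε.le hε1 hρ1 P Q hP hQ hPQ
    simp only [zero_mul, sub_zero, zero_add] at sc
    have e00 : ℓ 0 0 = ∑ k ∈ range ρ, ‖G s((![0, k], 0), (![0 - 1, k], 1))‖ := by simp [hℓ]
    rw [← e00] at sc
    change ∑ s ∈ range ρ, ∑ t ∈ range ρ, (|_ - ℓ P Q / ρ| + |_ - ℓ P Q / ρ| + |_ - ℓ P Q / ρ|) ≤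
      50 * Real.sqrt ε * ρ * ℓ P Q at est
    set m := ℓ P Q / ρ with hm
    have hms : |m - s₀| ≤ 700 * ε * ℓ 0 0 / ρ := by
      rw [hm, hs₀, ← sub_div, abs_div, abs_of_pos hρR]
      exact div_le_div_of_nonneg_right sc hρR.le
    have step : ∑ s ∈ range ρ, ∑ t ∈ range ρ,
        (|‖G s((![P * ρ - Q * ρ + s - t, Q * ρ + t], 0), (![P * ρ - Q * ρ + s - t, Q * ρ + t - 1], 1))‖ - s₀| +
          |‖G s((![P * ρ - Q * ρ + s - t, Q * ρ + t], 0), (![P * ρ - Q * ρ + s - t - 1, Q * ρ + t], 1))‖ - s₀| +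
          |‖G s((![P * ρ - Q * ρ + s - t, Q * ρ + t], 0), (![P * ρ - Q * ρ + s - t, Q * ρ + t], 1))‖ - s₀|) ≤
        ∑ s ∈ range ρ, ∑ t ∈ range ρ,
          (|‖G s((![P * ρ - Q * ρ + s - t, Q * ρ + t], 0), (![P * ρ - Q * ρ + s - t, Q * ρ + t - 1], 1))‖ - m| +
            |‖G s((![P * ρ - Q * ρ + s - t, Q * ρ + t], 0), (![P * ρ - Q * ρ + s - t - 1, Q * ρ + t], 1))‖ - m| +
            |‖G s((![P * ρ - Q * ρ + s - t, Q * ρ + t], 0), (![P * ρ - Q * ρ + s - t, Q * ρ + t], 1))‖ - m| + 3 * |m - s₀|) := by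
      refine Finset.sum_le_sum fun s _ => Finset.sum_le_sum fun t _ => ?_
      linarith [abs_sub_le ‖G s((![P * ρ - Q * ρ + s - t, Q * ρ + t], 0), (![P * ρ - Q * ρ + s - t, Q * ρ + t - 1], 1))‖ m s₀,
        abs_sub_le ‖G s((![P * ρ - Q * ρ + s - t, Q * ρ + t], 0), (![P * ρ - Q * ρ + s - t - 1, Q * ρ + t], 1))‖ m s₀,
        abs_sub_le ‖G s((![P * ρ - Q * ρ + s - t, Q * ρ + t], 0), (![P * ρ - Q * ρ + s - t, Q * ρ + t], 1))‖ m s₀]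
    refine step.trans ?_
    simp only [Finset.sum_add_distrib, Finset.sum_const, Finset.card_range, nsmul_eq_mul]
    have h07 : 700 * ε * ℓ 0 0 ≤ 0.7 * ℓ 0 0 := mul_le_mul_of_nonneg_right (by linarith) (ℓnn 0 0)
    have hl : ℓ P Q ≤ 1.7 * ℓ 0 0 := by have := (abs_le.1 sc).2; linarith
    have t1 : 50 * Real.sqrt ε * ρ * ℓ P Q ≤ 50 * Real.sqrt ε * ρ * (1.7 * ℓ 0 0) :=
      mul_le_mul_of_nonneg_left hl (by positivity)
    have t2 : (ρ : ℝ) * (ρ * (3 * |m - s₀|)) ≤ ρ * (ρ * (3 * (700 * ε * ℓ 0 0 / ρ))) := by gcongr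
    have t3 : (ρ : ℝ) * (ρ * (3 * (700 * ε * ℓ 0 0 / ρ))) = 2100 * ε * ρ * ℓ 0 0 := by
      field_simp; ring
    have t4 : 2100 * ε * ρ * ℓ 0 0 ≤ 70 * Real.sqrt ε * ρ * ℓ 0 0 := by
      have : 2100 * ε ≤ 70 * Real.sqrt ε := by
        have h' := mul_le_mul_of_nonneg_right hsε1 hsε0
        rw [← hsε] at h'; linarith
      exact mul_le_mul_of_nonneg_right (mul_le_mul_of_nonneg_right this hρR.le) (ℓnn 0 0)
    have est' : ∑ s ∈ range ρ, ∑ t ∈ range ρ,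
        (|‖G s((![P * ρ - Q * ρ + s - t, Q * ρ + t], 0), (![P * ρ - Q * ρ + s - t, Q * ρ + t - 1], 1))‖ - m| +
          |‖G s((![P * ρ - Q * ρ + s - t, Q * ρ + t], 0), (![P * ρ - Q * ρ + s - t - 1, Q * ρ + t], 1))‖ - m| +
          |‖G s((![P * ρ - Q * ρ + s - t, Q * ρ + t], 0), (![P * ρ - Q * ρ + s - t, Q * ρ + t], 1))‖ - m|) ≤ 50 * Real.sqrt ε * ρ * ℓ P Q := est
    simp only [Finset.sum_add_distrib] at est'
    have t5 : 0 ≤ Real.sqrt ε * ρ * ℓ 0 0 := by positivity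
    linarith [est', t1, t2, t3, t4, t5]
  -- the index set of tiles
  set T : Finset (ℤ × ℤ) := ((Icc (-10 : ℤ) 10) ×ˢ (Icc (-10 : ℤ) 10)).filter
    (fun PQ => |PQ.1 - PQ.2| ≤ 10) with hT
  have hTcard : (T.card : ℝ) ≤ 441 := by
    have : T.card ≤ ((Icc (-10 : ℤ) 10) ×ˢ (Icc (-10 : ℤ) 10)).card := Finset.card_filter_le _ _
    rw [Finset.card_product, Int.card_Icc] at this
    norm_num at this
    exact_mod_cast this
  have hTmem : ∀ PQ ∈ T, |PQ.1| ≤ 10 ∧ |PQ.2| ≤ 10 ∧ |PQ.1 - PQ.2| ≤ 10 := by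
    intro PQ h
    rw [hT, Finset.mem_filter, Finset.mem_product, Finset.mem_Icc, Finset.mem_Icc] at h
    exact ⟨abs_le.2 ⟨h.1.1.1, h.1.1.2⟩, abs_le.2 ⟨h.1.2.1, h.1.2.2⟩, h.2⟩
  -- the parametrisation of the edges and the big sum
  set Φ : (ℤ × ℤ) × (ℕ × ℕ) × ℕ → Sym2 HexVertex := fun i =>
    if i.2.2 = 0 then s((![i.1.1 * ρ - i.1.2 * ρ + i.2.1.1 - i.2.1.2, i.1.2 * ρ + i.2.1.2], 0), (![i.1.1 * ρ - i.1.2 * ρ + i.2.1.1 - i.2.1.2, i.1.2 * ρ + i.2.1.2 - 1], 1))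
    else if i.2.2 = 1 then s((![i.1.1 * ρ - i.1.2 * ρ + i.2.1.1 - i.2.1.2, i.1.2 * ρ + i.2.1.2], 0), (![i.1.1 * ρ - i.1.2 * ρ + i.2.1.1 - i.2.1.2 - 1, i.1.2 * ρ + i.2.1.2], 1))
    else s((![i.1.1 * ρ - i.1.2 * ρ + i.2.1.1 - i.2.1.2, i.1.2 * ρ + i.2.1.2], 0), (![i.1.1 * ρ - i.1.2 * ρ + i.2.1.1 - i.2.1.2, i.1.2 * ρ + i.2.1.2], 1)) with hΦ
  set TI := T ×ˢ ((range ρ ×ˢ range ρ) ×ˢ range 3) with hTI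
  set g : Sym2 HexVertex → ℝ := fun e => |‖G e‖ / s₀ - 1| with hg
  have g0 : ∀ e, 0 ≤ g e := fun e => abs_nonneg _
  have hgs : ∀ e, g e = |‖G e‖ - s₀| / s₀ := by
    intro e
    rw [hg]
    simp only
    rw [← abs_of_pos hs₀pos, ← abs_div, abs_of_pos hs₀pos, sub_div, div_self hs₀pos.ne']
  have big : ∑ i ∈ TI, g (Φ i) ≤ 441 * (160 * Real.sqrt ε * ρ * ℓ 0 0) / s₀ := by
    rw [hTI, Finset.sum_product]
    have inner : ∀ PQ ∈ T, ∑ x ∈ (range ρ ×ˢ range ρ) ×ˢ range 3, g (Φ (PQ, x)) ≤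
        (160 * Real.sqrt ε * ρ * ℓ 0 0) / s₀ := by
      intro PQ hPQ
      obtain ⟨h1, h2, h3⟩ := hTmem PQ hPQ
      have ht := tile PQ.1 PQ.2 h1 h2 h3
      rw [Finset.sum_product, Finset.sum_product]
      rw [le_div_iff₀ hs₀pos, Finset.sum_mul]
      refine le_trans (le_of_eq ?_) ht
      refine Finset.sum_congr rfl fun s _ => ?_
      rw [Finset.sum_mul]
      refine Finset.sum_congr rfl fun t _ => ?_
      simp only [Finset.sum_range_succ, Finset.sum_range_zero, zero_add, hΦ, hgs]
      simp only [Nat.zero_ne_one, if_true, if_false, one_ne_zero,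
        show (2 : ℕ) ≠ 0 from by norm_num, show (2 : ℕ) ≠ 1 from by norm_num]
      field_simp
    calc ∑ PQ ∈ T, ∑ x ∈ (range ρ ×ˢ range ρ) ×ˢ range 3, g (Φ (PQ, x))
        ≤ ∑ PQ ∈ T, (160 * Real.sqrt ε * ρ * ℓ 0 0) / s₀ := Finset.sum_le_sum inner
      _ = T.card * ((160 * Real.sqrt ε * ρ * ℓ 0 0) / s₀) := by
          rw [Finset.sum_const, nsmul_eq_mul]
      _ ≤ 441 * ((160 * Real.sqrt ε * ρ * ℓ 0 0) / s₀) :=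
          mul_le_mul_of_nonneg_right hTcard (by positivity)
      _ = _ := by ring
  -- the covering
  set S : Set (Sym2 HexVertex) := {e | e ∈ hexDomainMidEdges Λ ∧
    (δ : ℂ) * hexMidpoint e ∈ Metric.closedBall (0 : ℂ) 1} with hS
  have hL : (1.155 : ℝ) * (1 / δ + 1) < 10 * ρ := by rw [h8] at hρgt; nlinarith
  have cover : S ⊆ ↑(TI.image Φ) := by
    intro e he
    rw [hS, Set.mem_setOf_eq] at he
    obtain ⟨⟨hedge, -⟩, hnorm'⟩ := he
    have hnorm : ‖(δ : ℂ) * hexMidpoint e‖ ≤ 1 := mem_closedBall_zero_iff.1 hnorm'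
    obtain ⟨a, b, hcase⟩ := rsd_edge_cases hedge
    -- the up face coordinates are small
    have hmid : ‖hexMidpoint e‖ ≤ 1 / δ := by
      rw [norm_mul, Complex.norm_real, Real.norm_of_nonneg hδ0.le] at hnorm
      rw [le_div_iff₀ hδ0]; linarith
    have hab : ‖(a : ℂ) + (b : ℂ) * triZeta‖ ≤ 1 / δ + 1 := by
      have key : ∀ off : ℂ, ‖off‖ ≤ 1 → hexMidpoint e = (a : ℂ) + (b : ℂ) * triZeta + off →
          ‖(a : ℂ) + (b : ℂ) * triZeta‖ ≤ 1 / δ + 1 := by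
        intro off hoff hm
        have : (a : ℂ) + (b : ℂ) * triZeta = hexMidpoint e - off := by rw [hm]; ring
        rw [this]
        exact (norm_sub_le _ _).trans (by linarith)
      rcases hcase with rfl | rfl | rfl
      · exact key ((1 + triZeta) / 2) (by
          rw [norm_div, Complex.norm_ofNat]; linarith [rsd_norm_one_add_triZeta_le])
          (rsd_hexMidpoint_A a b)
      · exact key (triZeta / 2) (by rw [norm_div, norm_triZeta]; norm_num) (rsd_hexMidpoint_B a b)
      · exact key (1 / 2) (by norm_num) (rsd_hexMidpoint_C a b)
    obtain ⟨ca, cb, cab⟩ := rsd_coords_le_of_norm_le hab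
    have bound : ∀ x : ℤ, |(x : ℝ)| ≤ 1.155 * (1 / δ + 1) → -(10 * (ρ : ℤ)) ≤ x ∧ x < 10 * ρ := by
      intro x hx
      have h1 := (abs_le.1 hx).1
      have h2 := (abs_le.1 hx).2
      constructor
      · have : (-(10 * ρ) : ℝ) ≤ x := by linarith
        exact_mod_cast this
      · have : (x : ℝ) < 10 * ρ := by linarith
        exact_mod_cast this
    obtain ⟨a1, a2⟩ := bound a ca
    obtain ⟨b1, b2⟩ := bound b cb
    obtain ⟨ab1, ab2⟩ := bound (a + b) (by push_cast; exact cab)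
    obtain ⟨P, Q, s, t, hP, hQ, hPQ, hs, ht, ea, eb⟩ :=
      rsd_cover_coords hρZ a1 a2.le b1 b2 ab1 ab2
    have hsN : s < ρ := by exact_mod_cast hs
    have htN : t < ρ := by exact_mod_cast ht
    have memTI : ∀ k, k < 3 → ((P, Q), (s, t), k) ∈ TI := by
      intro k hk
      rw [hTI, Finset.mem_product, Finset.mem_product, Finset.mem_product, hT, Finset.mem_filter,
        Finset.mem_product, Finset.mem_Icc, Finset.mem_Icc, Finset.mem_range, Finset.mem_range,
        Finset.mem_range]
      exact ⟨⟨⟨(abs_le.1 hP), (abs_le.1 hQ)⟩, hPQ⟩, ⟨hsN, htN⟩, hk⟩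
    rw [Finset.coe_image]
    rcases hcase with rfl | rfl | rfl
    · refine ⟨((P, Q), (s, t), 2), memTI 2 (by norm_num), ?_⟩
      simp only [hΦ, show (2 : ℕ) ≠ 0 from by norm_num, show (2 : ℕ) ≠ 1 from by norm_num,
        if_false, ← ea, ← eb]
    · refine ⟨((P, Q), (s, t), 1), memTI 1 (by norm_num), ?_⟩
      simp only [hΦ, one_ne_zero, if_false, if_true, ← ea, ← eb]
    · refine ⟨((P, Q), (s, t), 0), memTI 0 (by norm_num), ?_⟩
      simp only [hΦ, if_true, ← ea, ← eb]
  have hSfin : S.Finite := (Finset.finite_toSet _).subset cover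
  have fin_le : ∑ᶠ e ∈ S, g e ≤ ∑ i ∈ TI, g (Φ i) := by
    rw [finsum_mem_eq_finite_toFinset_sum _ hSfin]
    calc ∑ e ∈ hSfin.toFinset, g e ≤ ∑ e ∈ TI.image Φ, g e :=
          Finset.sum_le_sum_of_subset_of_nonneg (hSfin.toFinset_subset.2 cover) fun _ _ _ => g0 _
      _ ≤ ∑ i ∈ TI, g (Φ i) := Finset.sum_image_le_of_nonneg fun _ _ => g0 _
  -- conclusion
  have hℓs : ℓ 0 0 / s₀ = ρ := by rw [hs₀]; field_simp
  calc δ ^ 2 * ∑ᶠ e ∈ S, g e ≤ δ ^ 2 * (441 * (160 * Real.sqrt ε * ρ * ℓ 0 0) / s₀) :=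
        mul_le_mul_of_nonneg_left (fin_le.trans big) (sq_nonneg _)
    _ = 70560 * Real.sqrt ε * (ρ * δ) ^ 2 := by
        rw [mul_div_assoc, show 160 * Real.sqrt ε * ρ * ℓ 0 0 / s₀ =
          160 * Real.sqrt ε * ρ * (ℓ 0 0 / s₀) by ring, hℓs]
        ring
    _ ≤ 70560 * Real.sqrt ε * (1 / 8) ^ 2 := by
        have hρδ0 : 0 ≤ (ρ : ℝ) * δ := by positivity
        have := pow_le_pow_left₀ hρδ0 hρδ 2
        exact mul_le_mul_of_nonneg_left this (by positivity)
    _ ≤ 1200 * Real.sqrt ε := by nlinarith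

/-- **`RetrievalStabilityDisc` holds** (stmt-CriticalPhenomena-11413): retrieval stability in the
disc, `L = 0`.  Every solution of the Duminil-Copin–Smirnov vertex relations is the field of edge
derivatives of a lattice potential (a map of the triangulated disc into `ℂ`); if no edge is rotated
by more than `ε`, every lattice-equilateral triangle has three image sides of nearly equal length,
so on each rhombus tile every row has image length `≈ ℓ_D` (short diagonal) while the discrete
Green identity bounds `Σ λ²` by the area of the near-rhombic image `≈ (√3/2) ℓ_D²`; the variance
of the `2ρ²` values `λ = ‖G‖` is therefore `O(ε) ℓ_D²`, i.e. `‖G‖` is `ℓ¹`-close to the constant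
`ℓ_D/ρ`, uniformly in the mesh. [folklore] -/
theorem retrievalStabilityDisc_proof :
    Summit.CriticalPhenomena.SAWScalingLimit.Theses.SAWPhaseRetrieval.RetrievalStabilityDisc := by
  intro Λ
  dsimp only
  intro hΛ η hη
  set ε : ℝ := min (1 / 1000) ((η / 1200) ^ 2) with hεdef
  have hε0 : 0 < ε := lt_min (by norm_num) (by positivity)
  have hε1 : ε ≤ 1 / 1000 := min_le_left _ _
  have hε2 : 1200 * Real.sqrt ε ≤ η := by
    have : Real.sqrt ε ≤ η / 1200 := by
      rw [Real.sqrt_le_left (by positivity)]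
      exact min_le_right _ _
    linarith
  refine ⟨ε, hε0, ?_⟩
  have hK := hΛ (Metric.closedBall 0 2.95) (isCompact_closedBall 0 2.95)
    (Metric.closedBall_subset_ball (by norm_num))
  have hδev : ∀ᶠ δ : ℝ in nhdsWithin 0 (Set.Ioi 0), δ < 1 / 200 :=
    mem_nhdsWithin_of_mem_nhds (Iio_mem_nhds (by norm_num : (0 : ℝ) < 1 / 200))
  have hδpos : ∀ᶠ δ : ℝ in nhdsWithin 0 (Set.Ioi 0), 0 < δ := eventually_mem_nhdsWithin
  filter_upwards [hK, hδev, hδpos] with δ hKδ hδ1 hδ0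
  intro G hrelG hphaseG
  have hK' : ∀ v : HexVertex, ‖(δ : ℂ) * hexCenter v‖ ≤ 2.95 → v ∈ Λ δ := fun v hv =>
    hKδ v (mem_closedBall_zero_iff.2 hv)
  have hphase' : ∀ e : Sym2 HexVertex, e ∈ hexDomainMidEdges (Λ δ) →
      ‖(δ : ℂ) * hexMidpoint e‖ ≤ 2 → G e ≠ 0 ∧ ‖G e / ((‖G e‖ : ℝ) : ℂ) - 1‖ ≤ ε :=
    fun e he hn => hphaseG e ⟨he, mem_closedBall_zero_iff.2 hn⟩
  obtain ⟨s, hs, hmain⟩ := rsd_main (Λ δ) G hδ0 hδ1.le hε0 hε1 hK' hrelG hphase'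
  exact ⟨s, hs, hmain.trans hε2⟩

end Summit.CriticalPhenomena.SAWScalingLimit.Theorems
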